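import Summits.AtomisticToContinuum.BoseEinsteinCondensation.Theses.BECInsertionCorrector
import Summits.AtomisticToContinuum.BoseEinsteinCondensation.Theses.BECHeatBathGap
import Literature.MathematicalPhysics.QuantumManyBody.OneParticleMarginals
import HarnessLib

/-!
# Route `BECInsertionCorrector`, support item `DirichletRemovalBound` (stmt-AtomisticToContinuum-12061)

**The one-particle-removal form of the Penrose–Onsager criterion.** For an `(N+1)`-body wave
function `Φ` and an `N`-body wave function `Θ` put `g(y) = ∫ conj Θ(X) Φ(y, X) dX` (remove `N`
particles in the state `Θ` from `Φ`). Then, as operators, `γ_Φ ≥ (N+1) |g⟩⟨g|`, whence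
`(N+1) ‖g‖₂² ≤ λ_max(γ_Φ)`:

* `succ_mul_lintegral_sq_removal_le_maxOccupation` — the bound for measurable `Φ ∈ L²`,
  `‖Θ‖₂ ≤ 1` (no regularity, no box);
* `DirichletRemovalBound_proof` / `heatBathGap_dirichletRemovalBound_proof` — the route decls
  `DirichletRemovalBound` of `BECInsertionCorrector` and of `BECHeatBathGap` (same statement, Dirichlet
  trial states `Φ : TrialState (N+1) L`, `Θ : TrialState N L`), closing item
  stmt-AtomisticToContinuum-12061.

Proof (folklore; [PenroseOnsager1956] criterion, [LSSY2005, §1.2 (1.17)–(1.18)] definitions): with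
`G = ‖g‖₂²`, if `G = 0` there is nothing to show; `G ≤ ‖Φ‖₂² ‖Θ‖₂² < ∞` by Cauchy–Schwarz in `X` and
Tonelli; otherwise test `maxOccupation` with the normalised mode `φ = G^{-1/2} g`:
`λ_max ≥ (N+1) ∫ |f(Y)|² dY`, `f(Y) = ∫ conj φ(x) Φ(x, Y) dx`, and by Cauchy–Schwarz against `Θ` in `Y`
and Fubini, `‖Θ‖₂² ∫ |f|² ≥ |∫ f(Y) conj Θ(Y) dY|² = |∫ conj φ(x) g(x) dx|² = G`.
The Fubini step needs `(Y, x) ↦ conj φ(x) Φ(x, Y) conj Θ(Y)` integrable, which is Cauchy–Schwarz on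
the product space (`φ ⊗ Θ ∈ L²`, `Φ ∘ vecCons ∈ L²`).
-/

noncomputable section

open MeasureTheory
open scoped ENNReal NNReal ComplexConjugate

namespace Summit.AtomisticToContinuum.BoseEinsteinCondensation.Theorems

open Literature.MathematicalPhysics.QuantumManyBody.BoseGas

variable {N : ℕ}

/-- The removal integrand `(y, X) ↦ conj Θ(X) Φ(y, X)` is jointly measurable. [folklore] -/
theorem measurable_removalIntegrand {Φ : Config (N + 1) → ℂ} {Θ : Config N → ℂ}
    (hΦ : Measurable Φ) (hΘ : Measurable Θ) :
    Measurable fun p : Space × Config N => conj (Θ p.2) * Φ (Matrix.vecCons p.1 p.2) :=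
  (Complex.continuous_conj.measurable.comp (hΘ.comp measurable_snd)).mul
    (hΦ.comp measurable_vecCons)

/-- The removal amplitude `g(y) = ∫ conj Θ(X) Φ(y, X) dX` is measurable. [folklore] -/
theorem measurable_removalAmplitude {Φ : Config (N + 1) → ℂ} {Θ : Config N → ℂ}
    (hΦ : Measurable Φ) (hΘ : Measurable Θ) :
    Measurable fun y : Space => ∫ X, conj (Θ X) * Φ (Matrix.vecCons y X) :=
  ((measurable_removalIntegrand hΦ hΘ).stronglyMeasurable.integral_prod_right'
    (ν := (volume : Measure (Config N)))).measurable

/-- Cauchy–Schwarz in the removed variables: `|g(y)|² ≤ ‖Φ(y, ·)‖₂² ‖Θ‖₂²`. [folklore] -/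
theorem sq_nnnorm_removalAmplitude_le {Φ : Config (N + 1) → ℂ} {Θ : Config N → ℂ}
    (hΦ : Measurable Φ) (hΘ : Measurable Θ) (y : Space) :
    (‖∫ X, conj (Θ X) * Φ (Matrix.vecCons y X)‖₊ : ℝ≥0∞) ^ 2 ≤
      (∫⁻ X, (‖Φ (Matrix.vecCons y X)‖₊ : ℝ≥0∞) ^ 2) * ∫⁻ X, (‖Θ X‖₊ : ℝ≥0∞) ^ 2 := by
  have h := sq_nnnorm_integral_mul_conj_le (ν := (volume : Measure (Config N)))
    (f := fun X => Φ (Matrix.vecCons y X)) (g := Θ)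
    (hΦ.comp (measurable_vecCons_right y)).aemeasurable hΘ.aemeasurable
  have hfun : (fun X => conj (Θ X) * Φ (Matrix.vecCons y X)) =
      fun X => Φ (Matrix.vecCons y X) * conj (Θ X) := funext fun X => mul_comm _ _
  rw [hfun]
  exact h

/-- `‖g‖₂² ≤ ‖Φ‖₂²` when `‖Θ‖₂ ≤ 1` (Cauchy–Schwarz and Tonelli over the kept particle). [folklore] -/
theorem lintegral_sq_nnnorm_removalAmplitude_le {Φ : Config (N + 1) → ℂ} {Θ : Config N → ℂ}
    (hΦ : Measurable Φ) (hΘ : Measurable Θ) (hΘ1 : ∫⁻ X, (‖Θ X‖₊ : ℝ≥0∞) ^ 2 ≤ 1) :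
    ∫⁻ y, (‖∫ X, conj (Θ X) * Φ (Matrix.vecCons y X)‖₊ : ℝ≥0∞) ^ 2 ≤
      ∫⁻ Z, (‖Φ Z‖₊ : ℝ≥0∞) ^ 2 :=
  calc ∫⁻ y, (‖∫ X, conj (Θ X) * Φ (Matrix.vecCons y X)‖₊ : ℝ≥0∞) ^ 2
      ≤ ∫⁻ y, (∫⁻ X, (‖Φ (Matrix.vecCons y X)‖₊ : ℝ≥0∞) ^ 2) * ∫⁻ X, (‖Θ X‖₊ : ℝ≥0∞) ^ 2 :=
        lintegral_mono fun y => sq_nnnorm_removalAmplitude_le hΦ hΘ y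
    _ ≤ ∫⁻ y, ∫⁻ X, (‖Φ (Matrix.vecCons y X)‖₊ : ℝ≥0∞) ^ 2 :=
        lintegral_mono fun _ => mul_le_of_le_one_right zero_le hΘ1
    _ = ∫⁻ Z, (‖Φ Z‖₊ : ℝ≥0∞) ^ 2 :=
        lintegral_lintegral_vecCons (F := fun Z => (‖Φ Z‖₊ : ℝ≥0∞) ^ 2)
          (hΦ.nnnorm.coe_nnreal_ennreal.pow_const 2)

/-- Prepending the kept particle read on `(ℝ³)^N × ℝ³`, `(Y, x) ↦ (x, Y)`, preserves Lebesgue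
measure. [folklore] -/
theorem measurePreserving_vecCons_swap :
    MeasurePreserving (fun p : Config N × Space => (Matrix.vecCons p.2 p.1 : Config (N + 1)))
      ((volume : Measure (Config N)).prod (volume : Measure Space)) volume :=
  (measurePreserving_vecCons (n := N)).comp Measure.measurePreserving_swap

/-- **Integrability for Fubini.** For `φ ∈ L²(ℝ³)`, `Θ ∈ L²((ℝ³)^N)` and `Φ ∈ L²((ℝ³)^{N+1})`
(all measurable), `(Y, x) ↦ conj φ(x) Φ(x, Y) conj Θ(Y)` is integrable on `(ℝ³)^N × ℝ³`:
Cauchy–Schwarz on the product space with `φ ⊗ Θ` and `Φ ∘ vecCons` both square-integrable.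
[folklore] -/
theorem integrable_testIntegrand {Φ : Config (N + 1) → ℂ} {Θ : Config N → ℂ} {φ : Space → ℂ}
    (hΦ : Measurable Φ) (hΘ : Measurable Θ) (hφ : Measurable φ)
    (hΦfin : ∫⁻ Z, (‖Φ Z‖₊ : ℝ≥0∞) ^ 2 ≠ ⊤) (hΘfin : ∫⁻ X, (‖Θ X‖₊ : ℝ≥0∞) ^ 2 ≠ ⊤)
    (hφfin : ∫⁻ x, (‖φ x‖₊ : ℝ≥0∞) ^ 2 ≠ ⊤) :
    Integrable (fun p : Config N × Space =>
        conj (φ p.2) * Φ (Matrix.vecCons p.2 p.1) * conj (Θ p.1))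
      ((volume : Measure (Config N)).prod (volume : Measure Space)) := by
  set μ : Measure (Config N × Space) :=
    (volume : Measure (Config N)).prod (volume : Measure Space) with hμ
  have hconj : Measurable fun z : ℂ => conj z := Complex.continuous_conj.measurable
  have hΦv : Measurable fun p : Config N × Space => Φ (Matrix.vecCons p.2 p.1) :=
    hΦ.comp (measurable_vecCons.comp measurable_swap)
  have hHm : Measurable fun p : Config N × Space =>
      conj (φ p.2) * Φ (Matrix.vecCons p.2 p.1) * conj (Θ p.1) :=
    ((hconj.comp (hφ.comp measurable_snd)).mul hΦv).mul (hconj.comp (hΘ.comp measurable_fst))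
  refine ⟨hHm.aestronglyMeasurable, ?_⟩
  -- the two square-integrable factors `A = |Θ ⊗ φ|`, `B = |Φ ∘ vecCons|`
  set A : Config N × Space → ℝ≥0∞ := fun p => (‖Θ p.1‖₊ : ℝ≥0∞) * ‖φ p.2‖₊ with hA
  set B : Config N × Space → ℝ≥0∞ := fun p => (‖Φ (Matrix.vecCons p.2 p.1)‖₊ : ℝ≥0∞) with hB
  have hAm : Measurable A :=
    (hΘ.comp measurable_fst).nnnorm.coe_nnreal_ennreal.mul
      (hφ.comp measurable_snd).nnnorm.coe_nnreal_ennreal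
  have hBm : Measurable B := hΦv.nnnorm.coe_nnreal_ennreal
  have hA2 : ∫⁻ p, A p ^ 2 ∂μ ≠ ⊤ := by
    have h : ∫⁻ p, A p ^ 2 ∂μ =
        (∫⁻ X, (‖Θ X‖₊ : ℝ≥0∞) ^ 2) * ∫⁻ x, (‖φ x‖₊ : ℝ≥0∞) ^ 2 := by
      rw [hμ, ← lintegral_prod_mul (hΘ.nnnorm.coe_nnreal_ennreal.pow_const 2).aemeasurable
        (hφ.nnnorm.coe_nnreal_ennreal.pow_const 2).aemeasurable]
      exact lintegral_congr fun p => by rw [hA, mul_pow]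
    rw [h]
    exact ENNReal.mul_ne_top hΘfin hφfin
  have hB2 : ∫⁻ p, B p ^ 2 ∂μ ≠ ⊤ := by
    have h : ∫⁻ p, B p ^ 2 ∂μ = ∫⁻ Z, (‖Φ Z‖₊ : ℝ≥0∞) ^ 2 :=
      measurePreserving_vecCons_swap.lintegral_comp (hΦ.nnnorm.coe_nnreal_ennreal.pow_const 2)
    rw [h]
    exact hΦfin
  have hsq : (∫⁻ p, A p * B p ∂μ) ^ 2 ≤ (∫⁻ p, A p ^ 2 ∂μ) * ∫⁻ p, B p ^ 2 ∂μ :=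
    lintegral_mul_sq_le μ hAm.aemeasurable hBm.aemeasurable
  have hne : (∫⁻ p, A p * B p ∂μ) ^ 2 ≠ ⊤ := ne_top_of_le_ne_top (ENNReal.mul_ne_top hA2 hB2) hsq
  have hAB : ∫⁻ p, A p * B p ∂μ ≠ ⊤ := fun htop => hne (by rw [htop]; exact ENNReal.top_pow two_ne_zero)
  have hnorm : ∀ p : Config N × Space,
      ‖conj (φ p.2) * Φ (Matrix.vecCons p.2 p.1) * conj (Θ p.1)‖ₑ = A p * B p := by
    intro p
    rw [enorm_eq_nnnorm, nnnorm_mul, nnnorm_mul, RCLike.nnnorm_conj, RCLike.nnnorm_conj, hA, hB]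
    push_cast
    ring
  show ∫⁻ p, ‖conj (φ p.2) * Φ (Matrix.vecCons p.2 p.1) * conj (Θ p.1)‖ₑ ∂μ < ⊤
  simp_rw [hnorm]
  exact lt_top_iff_ne_top.2 hAB

/-- **Removal bound, `L²` form.** For measurable `Φ ∈ L²((ℝ³)^{N+1})` and measurable `Θ` with
`‖Θ‖₂ ≤ 1`, `(N+1) ∫ |∫ conj Θ(X) Φ(y, X) dX|² dy ≤ λ_max(γ_Φ)` (`maxOccupation`): the operator
inequality `γ_Φ ≥ (N+1) |g⟩⟨g|`, tested on `g/‖g‖`. [folklore] -/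
theorem succ_mul_lintegral_sq_removal_le_maxOccupation {Φ : Config (N + 1) → ℂ} {Θ : Config N → ℂ}
    (hΦ : Measurable Φ) (hΘ : Measurable Θ) (hΦfin : ∫⁻ Z, (‖Φ Z‖₊ : ℝ≥0∞) ^ 2 ≠ ⊤)
    (hΘ1 : ∫⁻ X, (‖Θ X‖₊ : ℝ≥0∞) ^ 2 ≤ 1) :
    ((N : ℝ≥0∞) + 1) * ∫⁻ y, (‖∫ X, conj (Θ X) * Φ (Matrix.vecCons y X)‖₊ : ℝ≥0∞) ^ 2 ≤
      maxOccupation (N + 1) Φ := by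
  set g : Space → ℂ := fun y => ∫ X, conj (Θ X) * Φ (Matrix.vecCons y X) with hg
  set G : ℝ≥0∞ := ∫⁻ y, (‖g y‖₊ : ℝ≥0∞) ^ 2 with hG
  have hgm : Measurable g := measurable_removalAmplitude hΦ hΘ
  have hΘfin : ∫⁻ X, (‖Θ X‖₊ : ℝ≥0∞) ^ 2 ≠ ⊤ := ne_top_of_le_ne_top ENNReal.one_ne_top hΘ1
  have hGfin : G ≠ ⊤ :=
    ne_top_of_le_ne_top hΦfin (lintegral_sq_nnnorm_removalAmplitude_le hΦ hΘ hΘ1)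
  rcases eq_or_ne G 0 with hG0 | hG0
  · rw [hG0, mul_zero]
    exact zero_le
  -- normalise `g`: `φ = k g`, `k = ‖g‖₂⁻¹`
  set c : ℝ≥0 := G.toNNReal with hc
  have hcG : (c : ℝ≥0∞) = G := ENNReal.coe_toNNReal hGfin
  have hc0 : c ≠ 0 := fun h => hG0 (by rw [← hcG, h, ENNReal.coe_zero])
  set k : ℝ≥0 := (NNReal.sqrt c)⁻¹ with hk
  have hsqc : NNReal.sqrt c ≠ 0 := by simpa using hc0
  have hk2 : (k : ℝ≥0∞) ^ 2 = G⁻¹ := by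
    rw [← hcG, hk, ENNReal.coe_inv hsqc, ← ENNReal.inv_pow, ← ENNReal.coe_pow, NNReal.sq_sqrt]
  have hknorm : ∀ z : ℂ, (‖(k : ℂ) * z‖₊ : ℝ≥0∞) = k * ‖z‖₊ := by
    intro z
    rw [nnnorm_mul, ENNReal.coe_mul]
    congr 2
    rw [show ((k : ℂ)) = ((k : ℝ) : ℂ) from rfl, Complex.nnnorm_real, NNReal.nnnorm_eq]
  set φ : Space → ℂ := fun x => (k : ℂ) * g x with hφ
  have hφm : Measurable φ := measurable_const.mul hgm
  have hφ1 : ∫⁻ x, (‖φ x‖₊ : ℝ≥0∞) ^ 2 = 1 := by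
    have h1 : ∀ x, (‖φ x‖₊ : ℝ≥0∞) ^ 2 = (k : ℝ≥0∞) ^ 2 * (‖g x‖₊ : ℝ≥0∞) ^ 2 := by
      intro x
      rw [hφ, hknorm, mul_pow]
    simp_rw [h1]
    rw [lintegral_const_mul _ (hgm.nnnorm.coe_nnreal_ennreal.pow_const 2), hk2]
    exact ENNReal.inv_mul_cancel hG0 hGfin
  -- the test slices `f(Y) = ∫ conj φ(x) Φ(x, Y) dx` of the occupation of `φ`
  set f : Config N → ℂ := fun Y => ∫ x, conj (φ x) * Φ (Matrix.vecCons x Y) with hf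
  have hconj : Measurable fun z : ℂ => conj z := Complex.continuous_conj.measurable
  have hFm : Measurable fun p : Config N × Space => conj (φ p.2) * Φ (Matrix.vecCons p.2 p.1) :=
    (hconj.comp (hφm.comp measurable_snd)).mul (hΦ.comp (measurable_vecCons.comp measurable_swap))
  have hfm : Measurable f :=
    (hFm.stronglyMeasurable.integral_prod_right' (ν := (volume : Measure Space))).measurable
  have hocc : occupation (N + 1) φ Φ = ((N : ℝ≥0∞) + 1) * ∫⁻ Y, (‖f Y‖₊ : ℝ≥0∞) ^ 2 := rfl
  have hle : occupation (N + 1) φ Φ ≤ maxOccupation (N + 1) Φ :=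
    occupation_le_maxOccupation Φ hφm.aestronglyMeasurable hφ1
  suffices hkey : G ≤ ∫⁻ Y, (‖f Y‖₊ : ℝ≥0∞) ^ 2 by
    calc ((N : ℝ≥0∞) + 1) * G ≤ ((N : ℝ≥0∞) + 1) * ∫⁻ Y, (‖f Y‖₊ : ℝ≥0∞) ^ 2 := by gcongr
      _ = occupation (N + 1) φ Φ := hocc.symm
      _ ≤ maxOccupation (N + 1) Φ := hle
  -- Fubini: `∫ f(Y) conj Θ(Y) dY = ∫ conj φ(x) g(x) dx = k ‖g‖₂²`
  have hHint : Integrable (fun p : Config N × Space =>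
        conj (φ p.2) * Φ (Matrix.vecCons p.2 p.1) * conj (Θ p.1))
      ((volume : Measure (Config N)).prod (volume : Measure Space)) :=
    integrable_testIntegrand hΦ hΘ hφm hΦfin hΘfin (by rw [hφ1]; exact ENNReal.one_ne_top)
  have hswap : ∫ Y, ∫ x, conj (φ x) * Φ (Matrix.vecCons x Y) * conj (Θ Y) =
      ∫ x, ∫ Y, conj (φ x) * Φ (Matrix.vecCons x Y) * conj (Θ Y) :=
    integral_integral_swap hHint
  have hL : ∫ Y, f Y * conj (Θ Y) = ∫ Y, ∫ x, conj (φ x) * Φ (Matrix.vecCons x Y) * conj (Θ Y) := by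
    refine integral_congr_ae (ae_of_all _ fun Y => ?_)
    simp only [hf]
    rw [← integral_mul_const]
  have hR : ∀ x, ∫ Y, conj (φ x) * Φ (Matrix.vecCons x Y) * conj (Θ Y) =
      (k : ℂ) * ((‖g x‖ ^ 2 : ℝ) : ℂ) := by
    intro x
    simp_rw [mul_assoc]
    rw [integral_const_mul]
    have hgx : ∫ Y, Φ (Matrix.vecCons x Y) * conj (Θ Y) = g x := by
      simp only [hg]
      exact integral_congr_ae (ae_of_all _ fun Y => mul_comm _ _)
    rw [hgx, hφ]
    simp only [map_mul]
    rw [show ((k : ℂ)) = ((k : ℝ) : ℂ) from rfl, Complex.conj_ofReal, mul_assoc, Complex.conj_mul',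
      Complex.ofReal_pow]
  have hint_eq : ∫ x, ‖g x‖ ^ 2 = G.toReal := by
    rw [integral_eq_lintegral_of_nonneg_ae (ae_of_all _ fun x => by positivity)
      (hgm.norm.pow_const 2).aestronglyMeasurable]
    have h2 : ∀ z : ℂ, ENNReal.ofReal (‖z‖ ^ 2) = (‖z‖₊ : ℝ≥0∞) ^ 2 := fun z => by
      rw [← ENNReal.coe_pow, ← ENNReal.ofReal_coe_nnreal, NNReal.coe_pow, coe_nnnorm]
    simp_rw [h2]
    rfl
  have hI : ∫ Y, f Y * conj (Θ Y) = (k : ℂ) * ((G.toReal : ℝ) : ℂ) := by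
    rw [hL, hswap]
    simp_rw [hR]
    rw [integral_const_mul, integral_complex_ofReal, hint_eq]
  have hInorm : (‖∫ Y, f Y * conj (Θ Y)‖₊ : ℝ≥0∞) = k * G := by
    rw [hI, hknorm, Complex.nnnorm_real, ← enorm_eq_nnnorm, Real.enorm_of_nonneg ENNReal.toReal_nonneg,
      ENNReal.ofReal_toReal hGfin]
  have hCS : (‖∫ Y, f Y * conj (Θ Y)‖₊ : ℝ≥0∞) ^ 2 ≤
      (∫⁻ Y, (‖f Y‖₊ : ℝ≥0∞) ^ 2) * ∫⁻ Y, (‖Θ Y‖₊ : ℝ≥0∞) ^ 2 :=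
    sq_nnnorm_integral_mul_conj_le hfm.aemeasurable hΘ.aemeasurable
  calc G = ((k : ℝ≥0∞) * G) ^ 2 := by
        rw [mul_pow, hk2, sq, ← mul_assoc, ENNReal.inv_mul_cancel hG0 hGfin, one_mul]
    _ = (‖∫ Y, f Y * conj (Θ Y)‖₊ : ℝ≥0∞) ^ 2 := by rw [hInorm]
    _ ≤ (∫⁻ Y, (‖f Y‖₊ : ℝ≥0∞) ^ 2) * ∫⁻ Y, (‖Θ Y‖₊ : ℝ≥0∞) ^ 2 := hCS
    _ ≤ ∫⁻ Y, (‖f Y‖₊ : ℝ≥0∞) ^ 2 := mul_le_of_le_one_right zero_le hΘ1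

/-- **Removal bound for Dirichlet trial states.** For `Φ : TrialState (N+1) L` and
`Θ : TrialState N L`, `(N+1) ∫ |∫ conj Θ(X) Φ(y, X) dX|² dy ≤ maxOccupation (N+1) Φ.ψ`.
[folklore] -/
theorem trialState_succ_mul_lintegral_sq_removal_le_maxOccupation {L : ℝ}
    (Φ : TrialState (N + 1) L) (Θ : TrialState N L) :
    ((N : ℝ≥0∞) + 1) * ∫⁻ y, (‖∫ X, conj (Θ.ψ X) * Φ.ψ (Matrix.vecCons y X)‖₊ : ℝ≥0∞) ^ 2 ≤
      maxOccupation (N + 1) Φ.ψ :=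
  succ_mul_lintegral_sq_removal_le_maxOccupation Φ.contDiff.continuous.measurable
    Θ.contDiff.continuous.measurable (by rw [Φ.norm_eq]; exact ENNReal.one_ne_top) Θ.norm_eq.le

/-- **Item stmt-AtomisticToContinuum-12061** (`DirichletRemovalBound` of route
`BECInsertionCorrector`): the mode-free removal bound in any box. [folklore] -/
theorem DirichletRemovalBound_proof :
    Summit.AtomisticToContinuum.BoseEinsteinCondensation.Theses.BECInsertionCorrector.DirichletRemovalBound := by
  unfold Summit.AtomisticToContinuum.BoseEinsteinCondensation.Theses.BECInsertionCorrector.DirichletRemovalBound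
  intro N L Φ Θ
  exact trialState_succ_mul_lintegral_sq_removal_le_maxOccupation Φ Θ

/-- The same statement as decl `DirichletRemovalBound` of route `BECHeatBathGap` (the item is wanted by
both routes). [folklore] -/
theorem heatBathGap_dirichletRemovalBound_proof :
    Summit.AtomisticToContinuum.BoseEinsteinCondensation.Theses.BECHeatBathGap.DirichletRemovalBound := by
  unfold Summit.AtomisticToContinuum.BoseEinsteinCondensation.Theses.BECHeatBathGap.DirichletRemovalBound
  intro N L Φ Θ
  exact trialState_succ_mul_lintegral_sq_removal_le_maxOccupation Φ Θ

end Summit.AtomisticToContinuum.BoseEinsteinCondensation.Theorems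

end
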